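import Literature.NumberTheory.EllipticCurves.SupersingularDensitySerreOpenImageProofs
import Literature.NumberTheory.EllipticCurves.HasseWeilGoodReductionProofs
import Literature.NumberTheory.LFunctions.ChebotarevSquareCentralProofs
import HarnessLib

/-!
# Density `0` of the supersingular primes (Serre) — proofs, part 10: the `ℓ`-adic route
# (Serre 1968, IV-13), conditional only on "`ρ_{E,ℓ}(Γ_ℚ)` is not virtually abelian"

Tenth `…Proofs` file (theorems only, nothing is defined, no named fact) of the series working
towards the named fact `WeierstrassCurve.serre_supersingular_density_zero` of
`Literature.NumberTheory.EllipticCurves.SupersingularDensity` (J.-P. Serre, *Quelques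
applications du théorème de densité de Chebotarev*, Publ. Math. IHÉS 54 (1981), §8, Thm. 20 and
Cor. 2; the qualitative statement "for `E/ℚ` without complex multiplication the supersingular
primes have density `0`" is p. 123, (a), attributed there to Serre, *Abelian ℓ-adic
representations and elliptic curves* (1968), IV-13, Exercise 1).

Part 9 (`SupersingularDensitySerreOpenImageProofs`) proved the fact from Serre's open image theorem
in mod-`ℓ` form (`serre_open_image`, Serre 1972 — an undischarged named fact).  This part gives a
second, independent conditional proof whose only input is the **`ℓ`-adic** statement behind
Serre's 1968 exercise, in the weak form

> (H)  for some prime `ℓ` and every `n ≥ 0` there are `σ, τ ∈ Gal(ℚ̄/ℚ(E[ℓⁿ]))` and a level `m`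
>      such that the commutator `σ⁻¹τ⁻¹στ` does **not** act on `E[ℓᵐ]` as multiplication by an
>      integer

— i.e. no open subgroup of `ρ_{E,ℓ}(Γ_ℚ) ⊆ GL₂(ℤ_ℓ)` has all its commutators scalar; since a
scalar commutator in `GL₂(ℤ_ℓ)` congruent to `1 mod ℓⁿ` (`ℓⁿ > 2`) is trivial, (H) says exactly that
**`ρ_{E,ℓ}(Gal(ℚ̄/ℚ(E[ℓⁿ])))` is non-abelian for every `n`**, i.e. that the `ℓ`-adic image is not
virtually abelian.  For a curve without complex multiplication this is the first consequence of
Serre's determination `𝔤_ℓ = 𝔤𝔩₂` of the `ℓ`-adic Lie algebra (1968, IV.2.2); in the tree it is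
the content of the residual named fact of Faltings' Satz 4 for elliptic curves,
`Literature.AlgebraicGeometry.Motives.exists_eq_smul_one_of_equivariant_of_not_hasRationalCM`
(`FaltingsECEndCore`), granted the irreducibility of `V_ℓ E` over every number field (a theorem of
the tree, `finrank_ne_one_of_stable_of_not_hasRationalCM_of_isogenyClass`).  It is strictly
weaker than `serre_open_image` (whose proof needs it, plus Serre 1972 §§1–2).

* `WeierstrassCurve.hasPrimeDensity_goodSupersingularPrimes_zero_of_commutator_not_scalar` — for an
  elliptic curve `E/ℚ` in global minimal form and a prime `ℓ` satisfying (H), the good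
  supersingular primes of `E` have natural density `0`;
* `WeierstrassCurve.serre_supersingular_density_zero_of_commutator_not_scalar` — hence the named
  fact `serre_supersingular_density_zero`, granted (H) for every non-CM curve over `ℚ`.

## The argument (elementary given (H); no Lie theory, no Haar measure)

Fix `ℓ` and write `Γ = Γ_ℚ`, `V_k = ker ρ̄_{E,ℓᵏ} = Gal(ℚ̄/ℚ(E[ℓᵏ]))`, `G_k = Γ/V_k`,
`S_k = {γ ∈ Γ : γ acts on E[ℓᵏ] as an integer scalar}` (a subgroup containing `V_k`,
`exists_subgroup_forall_mem_iff_isScalar`), `Z_k = S_k/V_k ≤ G_k` (central), and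
`T_k = {q ∈ G_k : q² ∈ Z_k}`, `t_k = #T_k/#G_k`.
1. *Frobenius.* For a good prime `p ≥ 5`, `p ≠ ℓ`, with `p ∣ a_p`: `a_p = 0` (Hasse, part 2), so
   by Cayley–Hamilton on the free rank-`2` module `T_ℓ E` (`charpoly_tateModule_eq`, with the
   tree's theorem `trace_galoisRepTate_frobenius_eq_frobeniusTrace`) every arithmetic Frobenius
   `σ_p` has `ρ_ℓ(σ_p)² = -det ρ_ℓ(σ_p)` **scalar**, hence `σ_p² ∈ S_k` for every `k`
   (`exists_forall_frobenius_sq_smul_eq`); and `E[ℓᵏ]` is unramified at `p`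
   (`galoisRepTorsion_eq_one_of_mem_inertia`).  So the good supersingular primes lie, up to
   `{2, 3, ℓ}`, in `frobPrimes (Γ → G_k) T_k` for every `k`.
2. *Chebotarev, upper bound.* By `Chebotarev.eventually_card_primesLE_filter_frobPrimes_sqCentral_le`
   (prime ideal theorem only) that set has upper natural density `≤ 2 t_k`.
3. *Contraction.* If `σ, τ ∈ V_n` have a commutator that is not scalar on `E[ℓᵐ]` then `m > n` and,
   by the contraction lemma of `Literature.GroupTheory.SquareCentralProofs` applied to
   `G_m ↠ G_n` (kernel `V_n/V_m`), `t_m ≤ ¾ t_n`.  Under (H) this can be iterated, so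
   `inf_k t_k = 0`, and the density is `0` by the squeeze of part 1.

## References

* [Serre1981] J.-P. Serre, Publ. Math. IHÉS 54 (1981), 123–201: p. 123 (a), §8 Thm. 20, Cor. 2.
* [Serre1968] J.-P. Serre, *Abelian ℓ-adic representations and elliptic curves*, Benjamin 1968,
  IV-13 Exercise 1; IV.2.2.
* [SilvermanAEC2009] J. H. Silverman, *The Arithmetic of Elliptic Curves*, 2nd ed., III.§7,
  Prop. VII.4.1, C.21 Remark 21.3.
-/

noncomputable section

open scoped Classical NumberField
open IsDedekindDomain Field Filter Polynomial

universe u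

namespace WeierstrassCurve

open Literature.NumberTheory.EllipticCurves Literature.NumberTheory.GaloisRepresentations
  Literature.NumberTheory.LFunctions Literature.NumberTheory.LFunctions.Chebotarev NumberField
  Rat.HeightOneSpectrum Literature.GroupTheory.SquareCentral

/-! ### Scalars on `E[n]`: the subgroup `S_n ≤ Γ_F` and its basic properties (any base field) -/

section Scalars

variable {F : Type u} [Field F] (W : WeierstrassCurve F)

/-- `ρ̄_{E,n}(σ) = 1` iff `σ` fixes `E[n]` pointwise. [folklore] -/
theorem galoisRepTorsion_eq_one_iff (n : ℤ) (σ : absoluteGaloisGroup F) :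
    galoisRepTorsion W n σ = 1 ↔ ∀ P : geomTorsion W n, σ • P = P := by
  constructor
  · intro h P
    rw [← galoisRepTorsion_apply, h]
    rfl
  · intro h
    refine Multiplicative.toAdd.injective (AddEquiv.ext fun P ↦ ?_)
    rw [galoisRepTorsion_apply]
    exact h P

/-- If `σ` acts on `E[n]` as the integer scalar `c`, then so does every power `σ ^ j`, as `c ^ j`.
[folklore] -/
theorem pow_smul_eq_pow_zsmul_of_forall {n : ℤ} {σ : absoluteGaloisGroup F} {c : ℤ}
    (h : ∀ P : geomTorsion W n, σ • P = c • P) (j : ℕ) (P : geomTorsion W n) :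
    σ ^ j • P = c ^ j • P := by
  induction j with
  | zero => rw [pow_zero, pow_zero, one_smul, one_smul]
  | succ j ih => rw [pow_succ, mul_smul, h, smul_comm, ih, smul_smul, ← pow_succ']

/-- **The scalars on `E[n]` form a subgroup of `Γ_F`.**  For an elliptic curve `W/F` and `n ≠ 0`
there is a subgroup `S_n ≤ Γ_F` consisting exactly of the `σ` acting on `E[n]` as multiplication by
an integer.  (Closure under inverses: `ρ̄_{E,n}(σ)` has finite order `r` in the finite group
`Aut(E[n])`, so `σ⁻¹` acts as `σ^{r-1}`, i.e. as `c^{r-1}`.) [folklore] -/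
theorem exists_subgroup_forall_mem_iff_isScalar [W.IsElliptic] {n : ℤ} (hn : n ≠ 0) :
    ∃ S : Subgroup (absoluteGaloisGroup F),
      ∀ σ, σ ∈ S ↔ ∃ c : ℤ, ∀ P : geomTorsion W n, σ • P = c • P := by
  haveI : Finite (geomTorsion W n) := finite_torsionPoints_holds W (AlgebraicClosure F) hn
  haveI : Finite (AddAut (geomTorsion W n)) :=
    Finite.of_injective (fun e : AddAut (geomTorsion W n) ↦ (e : geomTorsion W n → geomTorsion W n))
      DFunLike.coe_injective
  haveI : Finite (Multiplicative (AddAut (geomTorsion W n))) := Finite.of_equiv _ Multiplicative.ofAdd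
  refine ⟨{ carrier := {σ | ∃ c : ℤ, ∀ P : geomTorsion W n, σ • P = c • P}
            mul_mem' := ?_, one_mem' := ⟨1, fun P ↦ by rw [one_smul, one_smul]⟩, inv_mem' := ?_ },
    fun σ ↦ Iff.rfl⟩
  · rintro σ τ ⟨c, hc⟩ ⟨d, hd⟩
    exact ⟨c * d, fun P ↦ by rw [mul_smul, hd, smul_comm, hc, smul_smul, mul_comm]⟩
  · rintro σ ⟨c, hc⟩
    -- `σ⁻¹` acts as `σ ^ (r - 1)`, `r` the order of `ρ̄(σ)`
    set r := orderOf (galoisRepTorsion W n σ) with hr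
    have hrpos : 0 < r := orderOf_pos _
    have hσr : ∀ P : geomTorsion W n, σ ^ r • P = P :=
      (galoisRepTorsion_eq_one_iff W n (σ ^ r)).mp (by rw [map_pow, hr, pow_orderOf_eq_one])
    have hpow : σ ^ r = σ * σ ^ (r - 1) := by
      rw [← pow_succ', Nat.sub_add_cancel hrpos]
    refine ⟨c ^ (r - 1), fun P ↦ ?_⟩
    calc σ⁻¹ • P = σ⁻¹ • (σ ^ r • P) := by rw [hσr]
      _ = σ ^ (r - 1) • P := by rw [← mul_smul, hpow, inv_mul_cancel_left]
      _ = c ^ (r - 1) • P := pow_smul_eq_pow_zsmul_of_forall W hc _ P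

/-- Elements acting trivially on `E[n]` are scalars (`c = 1`): `ker ρ̄_{E,n} ≤ S_n`. [folklore] -/
theorem ker_galoisRepTorsion_le_of_forall_mem_iff {n : ℤ} {S : Subgroup (absoluteGaloisGroup F)}
    (hS : ∀ σ, σ ∈ S ↔ ∃ c : ℤ, ∀ P : geomTorsion W n, σ • P = c • P) :
    (galoisRepTorsion W n).ker ≤ S := fun σ hσ ↦
  (hS σ).mpr ⟨1, fun P ↦ by
    rw [one_smul]
    exact (galoisRepTorsion_eq_one_iff W n σ).mp (MonoidHom.mem_ker.mp hσ) P⟩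

/-- Scalars commute with everything modulo `ker ρ̄_{E,n}`: for `σ ∈ S_n` and any `δ`,
`σ⁻¹ δ⁻¹ σ δ` acts trivially on `E[n]`. [folklore] -/
theorem commutator_mem_ker_of_isScalar {n : ℤ} {σ : absoluteGaloisGroup F} {c : ℤ}
    (hσ : ∀ P : geomTorsion W n, σ • P = c • P) (δ : absoluteGaloisGroup F) :
    σ⁻¹ * δ⁻¹ * σ * δ ∈ (galoisRepTorsion W n).ker := by
  rw [MonoidHom.mem_ker, galoisRepTorsion_eq_one_iff]
  intro P
  have hinv : ∀ Q : geomTorsion W n, σ⁻¹ • (c • Q) = Q := fun Q ↦ by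
    rw [← hσ Q, inv_smul_smul]
  rw [mul_smul, mul_smul, mul_smul, hσ, smul_comm δ⁻¹ c, inv_smul_smul, hinv]

/-- A scalar on `E[m]` is a scalar on `E[d]` for `d ∣ m` (`E[d] ⊆ E[m]`). [folklore] -/
theorem isScalar_of_dvd {d m : ℤ} (hdm : d ∣ m) {σ : absoluteGaloisGroup F} {c : ℤ}
    (hσ : ∀ P : geomTorsion W m, σ • P = c • P) (P : geomTorsion W d) : σ • P = c • P := by
  have hP : (P : geomPoints W) ∈ geomTorsion W m := by
    have h := (Submodule.mem_torsionBy_iff d (P : geomPoints W)).mp P.2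
    obtain ⟨k, rfl⟩ := hdm
    rw [geomTorsion, AddSubgroup.torsionBy]
    show (P : geomPoints W) ∈ Submodule.torsionBy ℤ (geomPoints W) (d * k)
    rw [Submodule.mem_torsionBy_iff, mul_comm, mul_smul, h, smul_zero]
  have h := congrArg (fun Q : geomTorsion W m ↦ (Q : geomPoints W)) (hσ ⟨P, hP⟩)
  simp only [AddSubgroup.torsionBy.coe_smul] at h
  exact Subtype.ext (by
    rw [AddSubgroup.torsionBy.coe_smul, AddSubgroupClass.coe_zsmul]
    exact h)

/-- `ker ρ̄_{E,m} ≤ ker ρ̄_{E,d}` for `d ∣ m`. [folklore] -/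
theorem ker_galoisRepTorsion_anti {d m : ℤ} (hdm : d ∣ m) :
    (galoisRepTorsion W m).ker ≤ (galoisRepTorsion W d).ker := by
  intro σ hσ
  rw [MonoidHom.mem_ker, galoisRepTorsion_eq_one_iff] at hσ ⊢
  intro P
  have h := isScalar_of_dvd W hdm (c := 1) (fun Q ↦ (hσ Q).trans (one_smul ℤ Q).symm) P
  exact h.trans (one_smul ℤ P)

end Scalars

/-! ### The square-central datum on the finite quotients `Γ/ker ρ̄_{E,n}` -/

section Quotients

variable {Γ : Type*} [Group Γ]

/-- For `V ≤ S`: `[γ] ∈ S/V ↔ γ ∈ S`. [folklore] -/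
theorem mk_mem_map_mk'_iff (V : Subgroup Γ) [V.Normal] {S : Subgroup Γ} (hVS : V ≤ S) (γ : Γ) :
    QuotientGroup.mk' V γ ∈ S.map (QuotientGroup.mk' V) ↔ γ ∈ S := by
  rw [Subgroup.mem_map]
  constructor
  · rintro ⟨x, hx, hxγ⟩
    rw [QuotientGroup.mk'_apply, QuotientGroup.mk'_apply, QuotientGroup.eq] at hxγ
    have : γ = x * (x⁻¹ * γ) := by rw [mul_inv_cancel_left]
    rw [this]
    exact S.mul_mem hx (hVS hxγ)
  · exact fun h ↦ ⟨γ, h, rfl⟩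

/-- `S/V` is central in `Γ/V` as soon as all commutators `s⁻¹δ⁻¹sδ` (`s ∈ S`) lie in `V`.
[folklore] -/
theorem map_mk'_le_center (V : Subgroup Γ) [V.Normal] {S : Subgroup Γ}
    (hS : ∀ s ∈ S, ∀ δ : Γ, s⁻¹ * δ⁻¹ * s * δ ∈ V) :
    S.map (QuotientGroup.mk' V) ≤ Subgroup.center (Γ ⧸ V) := by
  rintro q ⟨s, hs, rfl⟩
  rw [Subgroup.mem_center_iff]
  intro g
  obtain ⟨δ, rfl⟩ := QuotientGroup.mk'_surjective V g
  rw [← map_mul, ← map_mul, QuotientGroup.mk'_apply, QuotientGroup.mk'_apply, QuotientGroup.eq,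
    mul_inv_rev, ← mul_assoc]
  exact hS s hs δ

/-- The square of `[γ] ∈ Γ/V` lies in `S/V` iff `γ² ∈ S` (`V ≤ S`). [folklore] -/
theorem mk_sq_mem_map_iff (V : Subgroup Γ) [V.Normal] {S : Subgroup Γ} (hVS : V ≤ S) (γ : Γ) :
    (QuotientGroup.mk' V γ) ^ 2 ∈ S.map (QuotientGroup.mk' V) ↔ γ ^ 2 ∈ S := by
  rw [← map_pow, mk_mem_map_mk'_iff V hVS]

end Quotients

/-! ### Frobenius and inertia at level `ℓᵏ` -/

section Frobenius

variable (W : WeierstrassCurve ℚ) [W.IsElliptic] [W.IsGloballyMinimal]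

omit [W.IsGloballyMinimal] in
/-- **`E[ℓᵏ]` is unramified at a good prime `p ≠ ℓ`** (Silverman, *AEC*, Prop. VII.4.1(a), the
tree's `galoisRepTorsion_eq_one_of_mem_inertia`): `ρ̄_{E,ℓᵏ}` kills the inertia group of every
prime of `\bar ℤ` above `p`. [cite: SilvermanAEC2009, Prop. VII.4.1(a)] -/
theorem galoisRepTorsion_primePow_eq_one_of_mem_inertia (ℓ : ℕ) [Fact ℓ.Prime] (k : ℕ) {p : ℕ}
    [Fact p.Prime] (hpℓ : p ≠ ℓ) (hgood : W.HasGoodReductionAtPrime p)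
    {v : HeightOneSpectrum (𝓞 ℚ)} (hv : (primesEquiv v : ℕ) = p)
    {𝔓 : Ideal (absIntegers (𝓞 ℚ) ℚ)} (h𝔓 : 𝔓 ∈ v.primesAbove)
    {τ : absoluteGaloisGroup ℚ} (hτ : τ ∈ 𝔓.inertia (absoluteGaloisGroup ℚ)) :
    galoisRepTorsion W ((ℓ ^ k : ℕ) : ℤ) τ = 1 := by
  have hℓ : ℓ.Prime := Fact.out
  have hℓv : ((ℓ : ℕ) : 𝓞 ℚ) ∉ v.asIdeal := natCast_not_mem_asIdeal_of_primesEquiv_ne hℓ (hv ▸ hpℓ)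
  have hℓkv : ((((ℓ ^ k : ℕ) : ℤ)) : 𝓞 ℚ) ∉ v.asIdeal := by
    rw [Int.cast_natCast, Nat.cast_pow]
    exact fun h ↦ hℓv (v.isPrime.mem_of_pow_mem k h)
  have hgood' : W.HasGoodReductionAt v :=
    (hasGoodReductionAtPrime_primesEquiv_iff_holds W v p hv).mp hgood
  exact W.galoisRepTorsion_eq_one_of_mem_inertia hgood' hℓkv h𝔓 hτ

/-- **At a good prime `p ≠ ℓ` with `a_p = 0`, `Frob_p²` is a scalar on every `E[ℓᵏ]`.**  For an
arithmetic Frobenius `σ` at a prime of `\bar ℤ` above such a `p`: by Cayley–Hamilton on the free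
rank-`2` `ℤ_ℓ`-module `T_ℓ E` (`charpoly_tateModule_eq`) and `tr ρ_ℓ(σ) = a_p = 0` (the tree's
`trace_galoisRepTate_frobenius_eq_frobeniusTrace`, Silverman C.21.3), `ρ_ℓ(σ)² = -det ρ_ℓ(σ)`
is a scalar; reducing to `E[ℓᵏ] = T_ℓ E / ℓᵏ` (`proj_surjective_of_isAlgClosed_holds`,
`TateModule.proj_smul`) `σ²` acts on `E[ℓᵏ]` as an integer. (Serre 1981, p. 124: for such `p`,
`φ_p² = -p` in `GL₂`.) [cite: Serre1981, §8 and p. 124] -/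
theorem exists_forall_frobenius_sq_smul_eq (ℓ : ℕ) [Fact ℓ.Prime] (k : ℕ) {p : ℕ} [Fact p.Prime]
    (hpℓ : p ≠ ℓ) (hgood : W.HasGoodReductionAtPrime p) (hap : W.frobeniusTrace p = 0)
    {v : HeightOneSpectrum (𝓞 ℚ)} (hv : (primesEquiv v : ℕ) = p)
    {𝔓 : Ideal (absIntegers (𝓞 ℚ) ℚ)} (h𝔓 : 𝔓 ∈ v.primesAbove)
    {σ : absoluteGaloisGroup ℚ} (hσ : IsArithFrobAt (𝓞 ℚ) σ 𝔓) :
    ∃ c : ℤ, ∀ P : geomTorsion W ((ℓ ^ k : ℕ) : ℤ), (σ * σ) • P = c • P := by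
  have hℓ : ℓ.Prime := Fact.out
  have hℓ0 : (ℓ : ℚ) ≠ 0 := by exact_mod_cast hℓ.ne_zero
  haveI := module_free_tateModule_holds W ℓ
  haveI := module_finite_tateModule_holds W ℓ
  have hne : (primesEquiv v : ℕ) ≠ ℓ := hv ▸ hpℓ
  have hgood' : W.HasGoodReductionAt v :=
    (hasGoodReductionAtPrime_primesEquiv_iff_holds W v p hv).mp hgood
  set f := W.galoisRepTate ℓ σ with hf
  -- Cayley–Hamilton with trace `0`: `f (f a) = (-det f) • a`
  have htr : LinearMap.trace ℤ_[ℓ] _ f = 0 := by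
    rw [hf, W.trace_galoisRepTate_frobenius_eq_frobeniusTrace ℓ hne hgood' h𝔓 hσ, hv, hap,
      Int.cast_zero]
  have hCH := LinearMap.aeval_self_charpoly f
  rw [charpoly_tateModule_eq (W := W) hℓ0 f, htr, map_zero, zero_mul, sub_zero, map_add,
    map_pow, aeval_X, aeval_C, Module.algebraMap_end_eq_smul_id] at hCH
  have hff : ∀ a : W.tateModule ℓ, f (f a) = (-LinearMap.det f) • a := by
    intro a
    have h := congrArg (fun g : Module.End ℤ_[ℓ] (W.tateModule ℓ) ↦ g a) hCH
    simp only [LinearMap.add_apply, LinearMap.zero_apply, LinearMap.smul_apply, LinearMap.id_apply,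
      sq] at h
    rw [neg_smul, eq_neg_iff_add_eq_zero]
    simpa [Module.End.mul_apply] using h
  refine ⟨((PadicInt.toZModPow k (-LinearMap.det f)).val : ℤ), fun P ↦ Subtype.ext ?_⟩
  obtain ⟨a, ha⟩ := proj_surjective_of_isAlgClosed_holds W ℓ k P.2
  rw [AddSubgroup.torsionBy.coe_smul, AddSubgroupClass.coe_zsmul, ← ha, natCast_zsmul, mul_smul,
    ← TateModule.proj_smul_of_distribMulAction, ← TateModule.proj_smul_of_distribMulAction,
    ← TateModule.proj_smul]
  congr 1
  rw [← galoisRepTate_apply_apply, ← galoisRepTate_apply_apply]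
  exact hff a

end Frobenius

/-! ### Finiteness of the quotients `Γ/ker ρ̄_{E,n}` -/

section FiniteQuotient

variable {F : Type u} [Field F] (W : WeierstrassCurve F)

/-- `Gal(F(E[n])/F) = Γ_F / ker ρ̄_{E,n}` is finite (`n ≠ 0`): it embeds into `Aut(E[n])`, and `E[n]`
is finite (Silverman, *AEC*, Cor. III.6.4). [cite: SilvermanAEC2009, Cor. III.6.4] -/
theorem finite_quotient_ker_galoisRepTorsion [W.IsElliptic] {n : ℤ} (hn : n ≠ 0) :
    Finite (absoluteGaloisGroup F ⧸ (galoisRepTorsion W n).ker) := by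
  haveI : Finite (geomTorsion W n) := finite_torsionPoints_holds W (AlgebraicClosure F) hn
  haveI : Finite (AddAut (geomTorsion W n)) :=
    Finite.of_injective (fun e : AddAut (geomTorsion W n) ↦ (e : geomTorsion W n → geomTorsion W n))
      DFunLike.coe_injective
  haveI : Finite (Multiplicative (AddAut (geomTorsion W n))) := Finite.of_equiv _ Multiplicative.ofAdd
  exact Finite.of_equiv _ (QuotientGroup.quotientKerEquivRange (galoisRepTorsion W n)).toEquiv.symm

end FiniteQuotient

/-! ### The main theorem -/

section Main

variable (W : WeierstrassCurve ℚ) [W.IsElliptic] [W.IsGloballyMinimal]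

/-- **Density `0` of the supersingular primes, granted that `ρ_{E,ℓ}(Γ_ℚ)` is not virtually abelian
(Serre 1968, IV-13 Exercise 1, `ℓ`-adic route).**  Let `E/ℚ` be an elliptic curve in global minimal
form and `ℓ` a prime such that for every `n` there are `σ, τ ∈ Gal(ℚ̄/ℚ(E[ℓⁿ]))` (i.e.
`ρ̄_{E,ℓⁿ}(σ) = ρ̄_{E,ℓⁿ}(τ) = 1`) and a level `m` at which the commutator `σ⁻¹τ⁻¹στ` does not act on
`E[ℓᵐ]` as multiplication by an integer.  Then the good supersingular primes of `E`
(`goodSupersingularPrimes`: good `p` with `p ∣ a_p`) have natural density `0`.  Proof (module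
docstring): with `V_k = ker ρ̄_{E,ℓᵏ}`, `S_k` the scalars on `E[ℓᵏ]`
(`exists_subgroup_forall_mem_iff_isScalar`), `Z_k = S_k/V_k` central in `G_k = Γ/V_k` and
`t_k = #{q ∈ G_k : q² ∈ Z_k}/#G_k`: the hypothesis and the contraction lemma
(`Literature.GroupTheory.SquareCentral.natCard_sq_mem_div_le_of_commutator_not_mem` for
`G_m ↠ G_n`) give levels with `t_k ≤ (3/4)ʲ` for every `j`; the good supersingular primes `p ≥ 5`,
`p ≠ ℓ` lie in the Frobenius set of `{q : q² ∈ Z_k}` (`exists_forall_frobenius_sq_smul_eq`,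
`galoisRepTorsion_primePow_eq_one_of_mem_inertia`), whose counting function is eventually
`≤ (2 t_k + ε/2) π(x)` (`Chebotarev.eventually_card_primesLE_filter_frobPrimes_sqCentral_le`);
conclude by the squeeze `hasPrimeDensity_zero_of_forall_exists_superset` of part 1.
[cite: Serre1981, p. 123 (a) and §8 Thm. 20 Cor. 2] -/
theorem hasPrimeDensity_goodSupersingularPrimes_zero_of_commutator_not_scalar (ℓ : ℕ)
    [Fact ℓ.Prime]
    (hH : ∀ n : ℕ, ∃ (m : ℕ) (σ τ : absoluteGaloisGroup ℚ),
      galoisRepTorsion W ((ℓ ^ n : ℕ) : ℤ) σ = 1 ∧ galoisRepTorsion W ((ℓ ^ n : ℕ) : ℤ) τ = 1 ∧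
        ¬ ∃ c : ℤ, ∀ P : geomTorsion W ((ℓ ^ m : ℕ) : ℤ), (σ⁻¹ * τ⁻¹ * σ * τ) • P = c • P) :
    HasPrimeDensity W.goodSupersingularPrimes 0 := by
  have hℓ : ℓ.Prime := Fact.out
  have hN0 : ∀ k : ℕ, ((ℓ ^ k : ℕ) : ℤ) ≠ 0 := fun k ↦ by exact_mod_cast (pow_pos hℓ.pos k).ne'
  have hdvd : ∀ {j k : ℕ}, j ≤ k → ((ℓ ^ j : ℕ) : ℤ) ∣ ((ℓ ^ k : ℕ) : ℤ) := fun {j k} h ↦ by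
    exact_mod_cast pow_dvd_pow ℓ h
  -- `V k = ker ρ̄_{E,ℓᵏ}` (opaque), normal, open, of finite index
  obtain ⟨V, hV⟩ : ∃ V : ℕ → Subgroup (absoluteGaloisGroup ℚ),
      ∀ k, V k = (galoisRepTorsion W ((ℓ ^ k : ℕ) : ℤ)).ker := ⟨_, fun k ↦ rfl⟩
  haveI hVnormal : ∀ k, (V k).Normal := fun k ↦ by rw [hV]; infer_instance
  have hmemV : ∀ k σ, σ ∈ V k ↔ galoisRepTorsion W ((ℓ ^ k : ℕ) : ℤ) σ = 1 := fun k σ ↦ by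
    rw [hV, MonoidHom.mem_ker]
  have hfin : ∀ k, Finite (absoluteGaloisGroup ℚ ⧸ V k) := fun k ↦ by
    rw [hV k]
    exact finite_quotient_ker_galoisRepTorsion W (hN0 k)
  have hopen : ∀ k, IsOpen (V k : Set (absoluteGaloisGroup ℚ)) := fun k ↦ by
    rw [hV k]
    exact isOpen_ker_galoisRepTorsion_holds W (hN0 k)
  have hVanti : ∀ {j k : ℕ}, j ≤ k → V k ≤ V j := fun {j k} h ↦ by
    rw [hV, hV]
    exact ker_galoisRepTorsion_anti W (hdvd h)
  -- `S k` = scalars on `E[ℓᵏ]`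
  choose S hS using fun k : ℕ ↦ exists_subgroup_forall_mem_iff_isScalar W (hN0 k)
  have hVS : ∀ k, V k ≤ S k := fun k ↦ by
    rw [hV]
    exact ker_galoisRepTorsion_le_of_forall_mem_iff W (hS k)
  have hSanti : ∀ {j k : ℕ}, j ≤ k → S k ≤ S j := fun {j k} h σ hσ ↦ by
    obtain ⟨c, hc⟩ := (hS k σ).mp hσ
    exact (hS j σ).mpr ⟨c, fun P ↦ isScalar_of_dvd W (hdvd h) hc P⟩
  -- `Z k = S k / V k`, central in `Γ / V k`, and the ratio `t k`
  obtain ⟨Z, hZ⟩ : ∃ Z : ∀ k, Subgroup (absoluteGaloisGroup ℚ ⧸ V k),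
      ∀ k, Z k = (S k).map (QuotientGroup.mk' (V k)) := ⟨_, fun k ↦ rfl⟩
  have hZc : ∀ k, Z k ≤ Subgroup.center _ := fun k ↦ by
    rw [hZ]
    refine map_mk'_le_center (V k) fun s hs δ ↦ ?_
    obtain ⟨c, hc⟩ := (hS k s).mp hs
    rw [hV]
    exact commutator_mem_ker_of_isScalar W hc δ
  obtain ⟨t, ht⟩ : ∃ t : ℕ → ℝ, ∀ k,
      t k = (Nat.card {q : absoluteGaloisGroup ℚ ⧸ V k // q ^ 2 ∈ Z k} : ℝ) /
        Nat.card (absoluteGaloisGroup ℚ ⧸ V k) := ⟨_, fun k ↦ rfl⟩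
  have ht1 : ∀ k, t k ≤ 1 := fun k ↦ by
    haveI := hfin k
    rw [ht]
    have hG : (0 : ℝ) < Nat.card (absoluteGaloisGroup ℚ ⧸ V k) := by
      exact_mod_cast (Nat.card_pos (α := absoluteGaloisGroup ℚ ⧸ V k))
    rw [div_le_one hG]
    exact_mod_cast Nat.card_le_card_of_injective _ Subtype.val_injective
  -- contraction: from level `n` to the level `m` given by the hypothesis
  have hcontr : ∀ n : ℕ, ∃ m : ℕ, t m ≤ 3 / 4 * t n := by
    intro n
    obtain ⟨m, σ, τ, hσ, hτ, hnot⟩ := hH n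
    -- `m > n`: otherwise `σ, τ ∈ V n ≤ V m` and the commutator is the scalar `1` on `E[ℓᵐ]`
    have hnm : n ≤ m := by
      by_contra hlt
      push Not at hlt
      apply hnot
      refine ⟨1, fun P ↦ ?_⟩
      have hσm : σ ∈ V m := hVanti hlt.le ((hmemV n σ).mpr hσ)
      have hτm : τ ∈ V m := hVanti hlt.le ((hmemV n τ).mpr hτ)
      have hmem : σ⁻¹ * τ⁻¹ * σ * τ ∈ V m :=
        (V m).mul_mem ((V m).mul_mem ((V m).mul_mem ((V m).inv_mem hσm) ((V m).inv_mem hτm)) hσm)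
          hτm
      rw [one_smul]
      exact (galoisRepTorsion_eq_one_iff W _ _).mp ((hmemV m _).mp hmem) P
    haveI := hfin m
    haveI := hfin n
    set π : absoluteGaloisGroup ℚ ⧸ V m →* absoluteGaloisGroup ℚ ⧸ V n :=
      QuotientGroup.map (V m) (V n) (MonoidHom.id _) (hVanti hnm) with hπ
    have hπmk : ∀ γ, π (QuotientGroup.mk' (V m) γ) = QuotientGroup.mk' (V n) γ := fun γ ↦ by
      rw [hπ, QuotientGroup.mk'_apply, QuotientGroup.map_mk]
      rfl
    have hπsurj : Function.Surjective π := fun q ↦ by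
      obtain ⟨δ, rfl⟩ := QuotientGroup.mk'_surjective (V n) q
      exact ⟨QuotientGroup.mk' (V m) δ, hπmk δ⟩
    have hZQ : (Z m).map π ≤ Z n := by
      rintro _ ⟨q, hq, rfl⟩
      rw [hZ] at hq
      obtain ⟨γ, hγ, rfl⟩ := hq
      rw [hπmk, hZ, mk_mem_map_mk'_iff (V n) (hVS n)]
      exact hSanti hnm hγ
    have hK : ∃ u ∈ π.ker, ∃ v ∈ π.ker, u⁻¹ * v⁻¹ * u * v ∉ Z m := by
      refine ⟨QuotientGroup.mk' (V m) σ, ?_, QuotientGroup.mk' (V m) τ, ?_, ?_⟩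
      · rw [MonoidHom.mem_ker, hπmk, QuotientGroup.mk'_apply, QuotientGroup.eq_one_iff]
        exact (hmemV n σ).mpr hσ
      · rw [MonoidHom.mem_ker, hπmk, QuotientGroup.mk'_apply, QuotientGroup.eq_one_iff]
        exact (hmemV n τ).mpr hτ
      · rw [← map_inv, ← map_inv, ← map_mul, ← map_mul, ← map_mul, hZ,
          mk_mem_map_mk'_iff (V m) (hVS m), hS m]
        exact hnot
    refine ⟨m, ?_⟩
    rw [ht, ht]
    exact natCard_sq_mem_div_le_of_commutator_not_mem (hZc m) (Z n) π hπsurj hZQ hK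
  -- iterate: levels with `t k ≤ (3/4)^j`
  have hiter : ∀ j : ℕ, ∃ k : ℕ, t k ≤ (3 / 4 : ℝ) ^ j := by
    intro j
    induction j with
    | zero => exact ⟨0, by rw [pow_zero]; exact ht1 0⟩
    | succ j ih =>
      obtain ⟨k, hk⟩ := ih
      obtain ⟨m, hm⟩ := hcontr k
      exact ⟨m, hm.trans (by rw [pow_succ']; exact mul_le_mul_of_nonneg_left hk (by norm_num))⟩
  -- the squeeze
  refine hasPrimeDensity_zero_of_forall_exists_superset fun ε hε ↦ ?_
  obtain ⟨j, hj⟩ : ∃ j : ℕ, (3 / 4 : ℝ) ^ j < ε / 4 :=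
    exists_pow_lt_of_lt_one (by positivity) (by norm_num)
  obtain ⟨k, hk⟩ := hiter j
  haveI := hfin k
  set φ := QuotientGroup.mk' (V k) with hφ
  have hker : IsOpen (φ.ker : Set (absoluteGaloisGroup ℚ)) := by
    rw [hφ, QuotientGroup.ker_mk']
    exact hopen k
  have hsurj : Function.Surjective φ := QuotientGroup.mk'_surjective (V k)
  have hbound := eventually_card_primesLE_filter_frobPrimes_sqCentral_le φ hker hsurj (Z k) (hZc k)
    (half_pos hε)
  refine ⟨Chebotarev.frobPrimes φ {q | q ^ 2 ∈ Z k}, ?_, ?_⟩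
  · -- the good supersingular primes outside the Frobenius set are among `{p < 5} ∪ {ℓ}`
    refine ((Set.finite_lt_nat 5).union (Set.finite_singleton ℓ)).subset ?_
    rintro p ⟨hpSS, hpT⟩
    by_contra hcon
    simp only [Set.mem_union, Set.mem_setOf_eq, Set.mem_singleton_iff, not_or, not_lt] at hcon
    obtain ⟨hp5, hpℓ⟩ := hcon
    obtain ⟨hp, hgood, hdvdap⟩ := hpSS
    have hap : W.frobeniusTrace p = 0 :=
      (W.natCast_dvd_frobeniusTrace_iff_eq_zero p hp5 hgood).mp hdvdap
    obtain ⟨v, hv⟩ : ∃ v : HeightOneSpectrum (𝓞 ℚ), (primesEquiv v : ℕ) = p :=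
      ⟨primesEquiv.symm ⟨p, hp.out⟩, by rw [Equiv.apply_symm_apply]⟩
    refine hpT ⟨v, hv, fun 𝔓 h𝔓 τ hτ ↦ ?_, fun 𝔓 h𝔓 σ hσ ↦ ?_⟩
    · rw [hφ, QuotientGroup.mk'_apply, QuotientGroup.eq_one_iff, hmemV]
      exact W.galoisRepTorsion_primePow_eq_one_of_mem_inertia ℓ k hpℓ hgood hv h𝔓 hτ
    · rw [Set.mem_setOf_eq, hZ, mk_sq_mem_map_iff (V k) (hVS k), hS k, sq]
      exact W.exists_forall_frobenius_sq_smul_eq ℓ k hpℓ hgood hap hv h𝔓 hσ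
  · -- the counting ratio of the Frobenius set is eventually `≤ 2 t_k + ε/2 ≤ ε`
    have htk : (2 : ℝ) * Nat.card {q : absoluteGaloisGroup ℚ ⧸ V k // q ^ 2 ∈ Z k} /
        Nat.card (absoluteGaloisGroup ℚ ⧸ V k) ≤ ε / 2 := by
      rw [mul_div_assoc, ← ht]
      linarith
    filter_upwards [hbound] with x hx
    rw [primeCountingRatio_eq]
    rcases Nat.eq_zero_or_pos (Nat.primeCounting x) with h0 | hpos
    · rw [h0, Nat.cast_zero, div_zero]
      exact hε.le
    · have hpos' : (0 : ℝ) < Nat.primeCounting x := by exact_mod_cast hpos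
      rw [div_le_iff₀ hpos']
      refine hx.trans (mul_le_mul_of_nonneg_right ?_ hpos'.le)
      linarith

/-- **Serre 1981, p. 123 (a) / §8 Thm. 20 Cor. 2 ⇐ "the `ℓ`-adic image of a non-CM curve is not
virtually abelian".**  Granted, for every elliptic curve `E/ℚ` in global minimal form without
complex multiplication, a prime `ℓ` such that for every `n` some commutator of two elements of
`Gal(ℚ̄/ℚ(E[ℓⁿ]))` fails to act as an integer scalar on some `E[ℓᵐ]` (equivalently:
`ρ_{E,ℓ}(Gal(ℚ̄/ℚ(E[ℓⁿ])))` is non-abelian for every `n`; Serre 1968, IV.2.2 for non-CM curves —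
in the tree, the content of the residual Faltings fact
`Literature.AlgebraicGeometry.Motives.exists_eq_smul_one_of_equivariant_of_not_hasRationalCM`
over the fields `ℚ(E[ℓⁿ])`), the named fact `serre_supersingular_density_zero` holds:
`hasPrimeDensity_goodSupersingularPrimes_zero_of_commutator_not_scalar` curve by curve.
[cite: Serre1981, p. 123 (a) and §8 Thm. 20 Cor. 2] -/
theorem serre_supersingular_density_zero_of_commutator_not_scalar
    (hH : ∀ (W : WeierstrassCurve ℚ) [W.IsElliptic] [W.IsGloballyMinimal], ¬ W.HasCM →
      ∃ ℓ : ℕ, ℓ.Prime ∧ ∀ n : ℕ, ∃ (m : ℕ) (σ τ : absoluteGaloisGroup ℚ),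
        galoisRepTorsion W ((ℓ ^ n : ℕ) : ℤ) σ = 1 ∧ galoisRepTorsion W ((ℓ ^ n : ℕ) : ℤ) τ = 1 ∧
          ¬ ∃ c : ℤ, ∀ P : geomTorsion W ((ℓ ^ m : ℕ) : ℤ), (σ⁻¹ * τ⁻¹ * σ * τ) • P = c • P) :
    serre_supersingular_density_zero := by
  intro W _ _ hCM
  obtain ⟨ℓ, hℓ, h⟩ := hH W hCM
  haveI := Fact.mk hℓ
  exact hasPrimeDensity_goodSupersingularPrimes_zero_of_commutator_not_scalar W ℓ h

end Main

end WeierstrassCurve
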